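import Literature.Computability.Complexity.StackItemPop
import HarnessLib

/-!
# Item-list operations under arbitrary register names

Trunk complexity toolkit, continuing `StackItemLists.lean` (`pushItem` on the fixed register
type `PUReg`) and `StackItemPop.lean` (`popItemFast` on `PFReg`).  Programs of the numeric
layer (`StackNumeric.lean`: register type `EReg ⊕ β`, outer bank `β` arbitrary, `base T`,
`Runs.inr`) name their registers in `β`; to use the item bricks there one embeds them along
the register assignment given by the chosen names and reads the grafted file back as a chain
of `Function.update`s.  This file does that once, generically in `β`:

* `Com.pushOnto x s k` (`= pushItem.map (asg3 x s k)`): push the item `(T x, sg)` (sign read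
  off the flag register `s`) onto the list register `k`, emptying `x` and `s`;
  **`runs_pushOnto`**: `4|T x| + 5` steps, result `T[x := []][s := []][k := encItem (T x) sg ++ T k]`;
* `Com.popInto k x s w` (`= popItemFast.map (asg4 k x s w)`): pop the first item of the list
  `k` into `x` (payload) and `s` (sign flag), `w` the token scratch;
  **`runs_popInto`**: from `T k = encItem v sg ++ rest` and `x, s, w` empty, `8|v| + 10` steps,
  result `T[k := rest][x := v][s := flag sg][w := []]`; `runs_popInto_nil`: empty list, no change.

All hypotheses are distinctness of the names and emptiness of the scratch registers; lift to
`base T` with `Runs.inr`.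

## References

* S. Arora, B. Barak, *Computational Complexity: A Modern Approach*, CUP 2009, §0.1, §1.3.
* T. Nipkow, G. Klein, *Concrete Semantics with Isabelle/HOL*, Springer 2014, §7.2.
-/

namespace Literature.Computability.Complexity

open _root_.Computability

namespace Com

variable {β : Type} [DecidableEq β]

/-! ### Three names: `pushItem` -/

/-- The register assignment `PUReg → β` given by three names (payload, sign, list). [folklore] -/
def asg3 (x s k : β) : PUReg → β
  | .A => x | .S => s | .L => k

omit [DecidableEq β] in
/-- Distinct names give an injective assignment. [folklore] -/
theorem asg3_injective {x s k : β} (hxs : x ≠ s) (hxk : x ≠ k) (hsk : s ≠ k) :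
    Function.Injective (asg3 x s k) := by
  intro a b h
  cases a <;> cases b <;> simp only [asg3] at h <;> first
    | rfl | exact absurd h hxs | exact absurd h.symm hxs | exact absurd h hxk
    | exact absurd h.symm hxk | exact absurd h hsk | exact absurd h.symm hsk

/-- The graft along `asg3` is three updates. [folklore] -/
theorem graft_asg3 {x s k : β} (hxs : x ≠ s) (hxk : x ≠ k) (hsk : s ≠ k) (T : Regs β)
    (a' s' l' : List Bool) :
    graft T (asg3 x s k) (PUReg.file a' s' l') =
      Function.update (Function.update (Function.update T x a') s s') k l' := by
  have hinj := asg3_injective hxs hxk hsk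
  funext r
  by_cases hrk : r = k
  · subst hrk
    rw [Function.update_self]
    exact graft_apply T hinj _ PUReg.L
  by_cases hrs : r = s
  · subst hrs
    rw [Function.update_of_ne hrk, Function.update_self]
    exact graft_apply T hinj _ PUReg.S
  by_cases hrx : r = x
  · subst hrx
    rw [Function.update_of_ne hrk, Function.update_of_ne hrs, Function.update_self]
    exact graft_apply T hinj _ PUReg.A
  rw [Function.update_of_ne hrk, Function.update_of_ne hrs, Function.update_of_ne hrx]
  exact graft_of_not T _ _ (fun i => by
    cases i
    · exact fun h => hrx h.symm
    · exact fun h => hrs h.symm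
    · exact fun h => hrk h.symm)

/-- `pushOnto x s k`: push the item `(x, sign in s)` onto the list `k`. [folklore] -/
def pushOnto (x s k : β) : Com β := pushItem.map (asg3 x s k)

/-- **Simulation of `pushOnto`**: with `T s = flag sg`, the item `encItem (T x) sg` is put on top
of `T k`, and `x`, `s` are emptied, within `4|T x| + 5` steps. [folklore] -/
theorem runs_pushOnto {x s k : β} (hxs : x ≠ s) (hxk : x ≠ k) (hsk : s ≠ k) (T : Regs β)
    (sg : Bool) (hs : T s = flag sg) :
    Runs (pushOnto x s k) T
      (Function.update (Function.update (Function.update T x []) s []) k (encItem (T x) sg ++ T k))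
      (4 * (T x).length + 5) := by
  have h := Runs.map (asg3_injective hxs hxk hsk) (runs_pushItem (T x) sg (T k)) T
    (fun i => by cases i <;> simp [asg3, hs])
  rwa [graft_asg3 hxs hxk hsk] at h

/-! ### Four names: `popItemFast` -/

/-- The register assignment `PFReg → β` given by four names (list, payload, sign, token).
[folklore] -/
def asg4 (k x s w : β) : PFReg → β
  | .L => k | .A => x | .S => s | .W => w

omit [DecidableEq β] in
/-- Distinct names give an injective assignment. [folklore] -/
theorem asg4_injective {k x s w : β} (hkx : k ≠ x) (hks : k ≠ s) (hkw : k ≠ w) (hxs : x ≠ s)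
    (hxw : x ≠ w) (hsw : s ≠ w) : Function.Injective (asg4 k x s w) := by
  intro a b h
  cases a <;> cases b <;> simp only [asg4] at h <;> first
    | rfl | exact absurd h hkx | exact absurd h.symm hkx | exact absurd h hks
    | exact absurd h.symm hks | exact absurd h hkw | exact absurd h.symm hkw
    | exact absurd h hxs | exact absurd h.symm hxs | exact absurd h hxw | exact absurd h.symm hxw
    | exact absurd h hsw | exact absurd h.symm hsw

/-- The graft along `asg4` is four updates. [folklore] -/
theorem graft_asg4 {k x s w : β} (hkx : k ≠ x) (hks : k ≠ s) (hkw : k ≠ w) (hxs : x ≠ s)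
    (hxw : x ≠ w) (hsw : s ≠ w) (T : Regs β) (l' a' s' w' : List Bool) :
    graft T (asg4 k x s w) (PFReg.file l' a' s' w') =
      Function.update (Function.update (Function.update (Function.update T k l') x a') s s')
        w w' := by
  have hinj := asg4_injective hkx hks hkw hxs hxw hsw
  funext r
  by_cases hrw : r = w
  · subst hrw
    rw [Function.update_self]
    exact graft_apply T hinj _ PFReg.W
  by_cases hrs : r = s
  · subst hrs
    rw [Function.update_of_ne hrw, Function.update_self]
    exact graft_apply T hinj _ PFReg.S
  by_cases hrx : r = x
  · subst hrx
    rw [Function.update_of_ne hrw, Function.update_of_ne hrs, Function.update_self]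
    exact graft_apply T hinj _ PFReg.A
  by_cases hrk : r = k
  · subst hrk
    rw [Function.update_of_ne hrw, Function.update_of_ne hrs, Function.update_of_ne hrx,
      Function.update_self]
    exact graft_apply T hinj _ PFReg.L
  rw [Function.update_of_ne hrw, Function.update_of_ne hrs, Function.update_of_ne hrx,
    Function.update_of_ne hrk]
  exact graft_of_not T _ _ (fun i => by
    cases i
    · exact fun h => hrk h.symm
    · exact fun h => hrx h.symm
    · exact fun h => hrs h.symm
    · exact fun h => hrw h.symm)

/-- `popInto k x s w`: pop the first item of the list `k` into `x` (payload) and `s` (sign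
flag), with token scratch `w`. [folklore] -/
def popInto (k x s w : β) : Com β := popItemFast.map (asg4 k x s w)

/-- **Simulation of `popInto`**: from `T k = encItem v sg ++ rest` with `x, s, w` empty, it
ends with `k := rest`, `x := v`, `s := flag sg`, `w := []`, within `8|v| + 10` steps —
independently of `rest`. [folklore] -/
theorem runs_popInto {k x s w : β} (hkx : k ≠ x) (hks : k ≠ s) (hkw : k ≠ w) (hxs : x ≠ s)
    (hxw : x ≠ w) (hsw : s ≠ w) (T : Regs β) {v rest : List Bool} {sg : Bool}
    (hk : T k = encItem v sg ++ rest) (hx : T x = []) (hs : T s = []) (hw : T w = []) :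
    Runs (popInto k x s w) T
      (Function.update (Function.update (Function.update (Function.update T k rest) x v)
        s (flag sg)) w [])
      (8 * v.length + 10) := by
  have h := Runs.map (asg4_injective hkx hks hkw hxs hxw hsw) (runs_popItemFast v sg rest []) T
    (fun i => by cases i <;> simp [asg4, hk, hx, hs, hw])
  rwa [graft_asg4 hkx hks hkw hxs hxw hsw, List.append_nil] at h

/-- `popInto` on an empty list changes nothing (`6` steps). [folklore] -/
theorem runs_popInto_nil {k x s w : β} (hkx : k ≠ x) (hks : k ≠ s) (hkw : k ≠ w) (hxs : x ≠ s)
    (hxw : x ≠ w) (hsw : s ≠ w) (T : Regs β) (hk : T k = []) (hs : T s = []) (hw : T w = []) :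
    Runs (popInto k x s w) T T 6 := by
  have h := Runs.map (asg4_injective hkx hks hkw hxs hxw hsw) (runs_popItemFast_nil (T x)) T
    (fun i => by cases i <;> simp [asg4, hk, hs, hw])
  rw [graft_asg4 hkx hks hkw hxs hxw hsw] at h
  have e : Function.update (Function.update (Function.update (Function.update T k []) x (T x))
      s []) w [] = T := by
    have ek : Function.update T k ([] : List Bool) = T := Function.update_eq_self_iff.2 hk.symm
    have es : Function.update T s ([] : List Bool) = T := Function.update_eq_self_iff.2 hs.symm
    have ew : Function.update T w ([] : List Bool) = T := Function.update_eq_self_iff.2 hw.symm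
    rw [ek, Function.update_eq_self, es, ew]
  rw [e] at h
  exact h

end Com

end Literature.Computability.Complexity
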